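import Summits.CriticalPhenomena.PercolationContinuityZ3.Theorems.PercNearOneGluingNoHeavyLowerTailThreePointProductFormFibreTreeAssembly
import HarnessLib

/-!
# (P) on tree-like fibres, III: vertex identities `S0`, `S0∪P1`, `S0∪P2` (Sahi programme, prover prim-sahi-p2 gen 59)

Support file (`--supports stmt-CriticalPhenomena-4575`, helper).  Standard axioms, no sorries, no named facts, no definitions.
Memo `run/shared/lean/prim/prim-sahi/FROM-prim-sahi-p2-gen59-ONE-STEP-LEMMA.md` §2, §8(2); `prim-sahi-p2/PROOF-E3.md` (68j), §69.

For a tree structure (see `…ThreePointProductFormFibreTreeAssembly`) and a trunk vertex `w` with `m` children, `ks` `s`-marks and `kc` `c`-marks, the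
statistics of the sub-instance at `w` (mask `mQ w`, apex `w`) satisfy the SCALED gen-58 recursion with `κ_w = U^(1+ks+kc)/(U^n 2^n)`, `n = m+ks+kc`,
`U = 2^(#α)`: `N_E(w) = κ_w · φS^ks · φC^kc · ∏_(u ∈ ch w) factor_E(u)` where `factor = (p+q, 2p+q−r, p+2q−r, p+g, q+g, r+g)` and
`(φS, φC) = ((1,1), (2,1), (1,2), (1,0), (0,1), (0,0))` for `E = (S0, isoC, isoS, Ga, Gb, G1)`, `(r,p,q,g) = (#S0, #isoC, #isoS, #good)` of the child.
Proof: n-ary parallel composition (parts IV–VI) over the family 'series pieces of the children + mark pieces', the series-piece and mark identities, and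
the normalisation algebra `assemble_eq`.
[this work] (gen 59).
-/

namespace Summit.CriticalPhenomena.PercolationContinuityZ3.Theorems.ProductFormFibre

open Finset Literature.Probability.Percolation
open Summit.CriticalPhenomena.PercolationContinuityZ3.Theorems.ThreePointCPIClusterSwap (clusterFlip)

variable {V α : Type*}

/-- `assemble_eq` with the hypothesis in the shape produced by the product splitting. [this work] -/
theorem assemble_eq' (N U X φS φC : ℝ) (m ks kc : ℕ) (hU : 0 < U)
    (hfam : N * U ^ (m + (ks + kc)) = U * (X / 2 ^ m * (((U / 2) * φS) ^ ks * ((U / 2) * φC) ^ kc))) :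
    N = (U ^ (1 + ks + kc) / (U ^ (m + ks + kc) * 2 ^ (m + ks + kc))) * (φS ^ ks * φC ^ kc * X) := by
  refine assemble_eq N U X φS φC m ks kc hU ?_
  rw [Nat.add_assoc, hfam]; ring

section Vertex

variable [Fintype α] [DecidableEq α] [DecidableEq V] (ends : α → Sym2 V) (s c : V)
  (T : V → Prop) (ch : V → Finset V) (mQ : V → α → Bool) (Sv : V → V → Prop) (e : V → α) (Ms Mc : V → Finset α)

open Classical in
/-- **Vertex identity, `S0`**: at a trunk vertex the statistic equals the scaled recursion product over the children. [this work] -/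
theorem vertex_S0
    (hsc : s ≠ c) (hT : ∀ v, T v → v ≠ s ∧ v ≠ c)
    (hch : ∀ v, T v → ∀ u ∈ ch v, T u)
    (he : ∀ v, T v → ∀ u ∈ ch v, ends (e u) = s(v, u))
    (hMs : ∀ v, T v → ∀ m ∈ Ms v, ends m = s(v, s)) (hMc : ∀ v, T v → ∀ m ∈ Mc v, ends m = s(v, c))
    (hmQ : ∀ v, T v → ∀ l, (mQ v l = true ↔ (∃ u ∈ ch v, l = e u ∨ mQ u l = true) ∨ l ∈ Ms v ∨ l ∈ Mc v))
    (hSv1 : ∀ u, T u → Sv u u)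
    (hSv2 : ∀ u, T u → ∀ l, mQ u l = true → (∀ x ∈ ends l, Sv u x ∨ (x = s ∨ x = c)) ∧ (∃ x ∈ ends l, Sv u x))
    (hSv3 : ∀ u, T u → ∀ x, Sv u x → x ≠ s ∧ x ≠ c)
    (hSv4 : ∀ v, T v → ∀ u ∈ ch v, ∀ x, Sv u x → x ≠ v)
    (hSv5 : ∀ v, T v → ∀ u ∈ ch v, ∀ u' ∈ ch v, u ≠ u' → ∀ x, Sv u x → ¬ Sv u' x)
    (w : V) (hw : T w) :
    ((((univ.filter fun z : α → Bool =>
        ((¬ (openGraph (labelledOpen ends (fun y => z y && mQ w y))).Reachable s w ∧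
        ¬ (openGraph (labelledOpen ends (fun y => z y && mQ w y))).Reachable s c) ∧
        (¬ (openGraph (labelledOpen ends (fun y => z y && mQ w y))).Reachable c w ∧
        ¬ (openGraph (labelledOpen ends (fun y => z y && mQ w y))).Reachable c s))).card) : ℕ) : ℝ) =
    (((univ : Finset (α → Bool)).card : ℝ) ^ (1 + (Ms w).card + (Mc w).card) /
      (((univ : Finset (α → Bool)).card : ℝ) ^ ((ch w).card + (Ms w).card + (Mc w).card) * 2 ^ ((ch w).card + (Ms w).card + (Mc w).card))) *
    (((1 : ℝ)) ^ (Ms w).card * ((1 : ℝ)) ^ (Mc w).card * ∏ u ∈ ch w, ((((univ.filter fun z : α → Bool =>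
        (¬ (openGraph (labelledOpen ends (fun y => z y && mQ u y))).Reachable c u ∧
        ¬ (openGraph (labelledOpen ends (fun y => z y && mQ u y))).Reachable c s)).card : ℕ) : ℝ) + (((univ.filter fun z : α → Bool =>
        (¬ (openGraph (labelledOpen ends (fun y => z y && mQ u y))).Reachable s u ∧
        ¬ (openGraph (labelledOpen ends (fun y => z y && mQ u y))).Reachable s c)).card : ℕ) : ℝ))) := by
  obtain ⟨hws, hwc⟩ := hT w hw
  obtain ⟨hQP, hPT, hP, hQ⟩ := family_hyps (ends := ends) (s := s) (c := c) (T := T) (ch := ch) (mQ := mQ) (Sv := Sv) (e := e) (Ms := Ms) (Mc := Mc) hT hch he hMs hMc hSv1 hSv2 hSv3 hSv4 hSv5 w hw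
  have hfam := card_parallel_family_S0 ends s w c
    (fun j => Sum.elim (fun u => fun y => decide (y = e u) || mQ u y) (fun m => fun y => decide (y = m)) j)
    (fun j => Sum.elim (fun u => Sv u) (fun _ => fun _ => False) j)
    (Ne.symm hws) (Ne.symm hwc) hsc
    ((ch w).map ⟨Sum.inl, Sum.inl_injective⟩ ∪ (Ms w ∪ Mc w).map ⟨Sum.inr, Sum.inr_injective⟩) hQP hPT hP hQ
  have hM : ∀ y, decide (∃ j ∈ (ch w).map ⟨Sum.inl, Sum.inl_injective⟩ ∪ (Ms w ∪ Mc w).map ⟨Sum.inr, Sum.inr_injective⟩,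
      (fun j => Sum.elim (fun u => fun y => decide (y = e u) || mQ u y) (fun m => fun y => decide (y = m)) j) j y = true) = mQ w y :=
    fun y => unionMask_eq (T := T) (ch := ch) (mQ := mQ) (e := e) (Ms := Ms) (Mc := Mc) hmQ w hw y
  simp only [hM] at hfam
  have hMM := marks_disjoint (ends := ends) (s := s) (c := c) (T := T) (Ms := Ms) (Mc := Mc) hsc hT hMs hMc w hw
  obtain ⟨hsplit, hcard⟩ := prod_family (ch := ch) (mQ := mQ) (e := e) (Ms := Ms) (Mc := Mc) w (fun mk : α → Bool => (((univ.filter fun z : α → Bool =>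
        ((¬ (openGraph (labelledOpen ends (fun y => z y && mk y))).Reachable s w ∧
        ¬ (openGraph (labelledOpen ends (fun y => z y && mk y))).Reachable s c) ∧
        (¬ (openGraph (labelledOpen ends (fun y => z y && mk y))).Reachable c w ∧
        ¬ (openGraph (labelledOpen ends (fun y => z y && mk y))).Reachable c s))).card : ℕ) : ℝ)) hMM
  have hfamR := congrArg (fun n : ℕ => (n : ℝ)) hfam
  simp only [Nat.cast_mul, Nat.cast_pow, Nat.cast_prod] at hfamR
  rw [hsplit, hcard] at hfamR
  -- the children: series pieces
  have hser : ∀ u ∈ ch w, ((((univ.filter fun z : α → Bool =>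
        ((¬ (openGraph (labelledOpen ends (fun y => z y && (decide (y = e u) || mQ u y)))).Reachable s w ∧
        ¬ (openGraph (labelledOpen ends (fun y => z y && (decide (y = e u) || mQ u y)))).Reachable s c) ∧
        (¬ (openGraph (labelledOpen ends (fun y => z y && (decide (y = e u) || mQ u y)))).Reachable c w ∧
        ¬ (openGraph (labelledOpen ends (fun y => z y && (decide (y = e u) || mQ u y)))).Reachable c s))).card) : ℕ) : ℝ) = ((((univ.filter fun z : α → Bool =>
        (¬ (openGraph (labelledOpen ends (fun y => z y && mQ u y))).Reachable c u ∧
        ¬ (openGraph (labelledOpen ends (fun y => z y && mQ u y))).Reachable c s)).card : ℕ) : ℝ) + (((univ.filter fun z : α → Bool =>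
        (¬ (openGraph (labelledOpen ends (fun y => z y && mQ u y))).Reachable s u ∧
        ¬ (openGraph (labelledOpen ends (fun y => z y && mQ u y))).Reachable s c)).card : ℕ) : ℝ)) / 2 := by
    intro u hu
    obtain ⟨hua, hQu, heQ⟩ := child_hyps (ends := ends) (s := s) (c := c) (T := T) (ch := ch) (mQ := mQ) (Sv := Sv) (e := e) hT hch he hSv1 hSv2 hSv4 w hw u hu
    have h2 := two_mul_card_series_S0_mask ends s w c u (e u) (mQ u) (he w hw u hu) hua (Ne.symm hws) (Ne.symm hwc) hQu heQ
    have hf := card_series_nsc_forms (ends := ends) (s := s) (c := c) (Qu := fun y => mQ u y = true)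
    have ha := card_series_nsc_add_S0 (ends := ends) (s := s) (c := c) (u := u) (Qu := fun y => mQ u y = true)
    simp only [Bool.decide_eq_true] at hf ha
    have hfR := congrArg (fun n : ℕ => (n : ℝ)) hf.1
    have haR := congrArg (fun n : ℕ => (n : ℝ)) ha
    push_cast at hfR haR
    have h2R := congrArg (fun n : ℕ => (n : ℝ)) h2
    push_cast at h2R
    linarith
  -- the marks
  have hmS : ∀ m ∈ Ms w, ((((univ.filter fun z : α → Bool =>
        ((¬ (openGraph (labelledOpen ends (fun y => z y && decide (y = m)))).Reachable s w ∧
        ¬ (openGraph (labelledOpen ends (fun y => z y && decide (y = m)))).Reachable s c) ∧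
        (¬ (openGraph (labelledOpen ends (fun y => z y && decide (y = m)))).Reachable c w ∧
        ¬ (openGraph (labelledOpen ends (fun y => z y && decide (y = m)))).Reachable c s))).card) : ℕ) : ℝ) = (((univ : Finset (α → Bool)).card : ℝ) / 2) * (1 : ℝ) := by
    intro m hm
    have h2 := two_mul_card_markS_S0 ends s w c m (hMs w hw m hm) (Ne.symm hws) (Ne.symm hwc) hsc
    have h2R := congrArg (fun n : ℕ => (n : ℝ)) h2
    push_cast at h2R
    linarith
  have hmC : ∀ m ∈ Mc w, ((((univ.filter fun z : α → Bool =>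
        ((¬ (openGraph (labelledOpen ends (fun y => z y && decide (y = m)))).Reachable s w ∧
        ¬ (openGraph (labelledOpen ends (fun y => z y && decide (y = m)))).Reachable s c) ∧
        (¬ (openGraph (labelledOpen ends (fun y => z y && decide (y = m)))).Reachable c w ∧
        ¬ (openGraph (labelledOpen ends (fun y => z y && decide (y = m)))).Reachable c s))).card) : ℕ) : ℝ) = (((univ : Finset (α → Bool)).card : ℝ) / 2) * (1 : ℝ) := by
    intro m hm
    have h2 := two_mul_card_markC_S0 ends s w c m (hMc w hw m hm) (Ne.symm hws) (Ne.symm hwc) hsc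
    have h2R := congrArg (fun n : ℕ => (n : ℝ)) h2
    push_cast at h2R
    linarith
  rw [Finset.prod_congr rfl hser, Finset.prod_congr rfl hmS, Finset.prod_congr rfl hmC, Finset.prod_div_distrib,
    Finset.prod_const, Finset.prod_const, Finset.prod_const] at hfamR
  have hU : (0 : ℝ) < ((univ : Finset (α → Bool)).card : ℝ) := by exact_mod_cast Finset.card_pos.mpr Finset.univ_nonempty
  exact assemble_eq' _ _ _ _ _ _ _ _ hU hfamR

open Classical in
/-- **Vertex identity, `isoC`**: at a trunk vertex the statistic equals the scaled recursion product over the children. [this work] -/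
theorem vertex_isoC
    (hsc : s ≠ c) (hT : ∀ v, T v → v ≠ s ∧ v ≠ c)
    (hch : ∀ v, T v → ∀ u ∈ ch v, T u)
    (he : ∀ v, T v → ∀ u ∈ ch v, ends (e u) = s(v, u))
    (hMs : ∀ v, T v → ∀ m ∈ Ms v, ends m = s(v, s)) (hMc : ∀ v, T v → ∀ m ∈ Mc v, ends m = s(v, c))
    (hmQ : ∀ v, T v → ∀ l, (mQ v l = true ↔ (∃ u ∈ ch v, l = e u ∨ mQ u l = true) ∨ l ∈ Ms v ∨ l ∈ Mc v))
    (hSv1 : ∀ u, T u → Sv u u)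
    (hSv2 : ∀ u, T u → ∀ l, mQ u l = true → (∀ x ∈ ends l, Sv u x ∨ (x = s ∨ x = c)) ∧ (∃ x ∈ ends l, Sv u x))
    (hSv3 : ∀ u, T u → ∀ x, Sv u x → x ≠ s ∧ x ≠ c)
    (hSv4 : ∀ v, T v → ∀ u ∈ ch v, ∀ x, Sv u x → x ≠ v)
    (hSv5 : ∀ v, T v → ∀ u ∈ ch v, ∀ u' ∈ ch v, u ≠ u' → ∀ x, Sv u x → ¬ Sv u' x)
    (w : V) (hw : T w) :
    ((((univ.filter fun z : α → Bool =>
        (¬ (openGraph (labelledOpen ends (fun y => z y && mQ w y))).Reachable c w ∧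
        ¬ (openGraph (labelledOpen ends (fun y => z y && mQ w y))).Reachable c s)).card) : ℕ) : ℝ) =
    (((univ : Finset (α → Bool)).card : ℝ) ^ (1 + (Ms w).card + (Mc w).card) /
      (((univ : Finset (α → Bool)).card : ℝ) ^ ((ch w).card + (Ms w).card + (Mc w).card) * 2 ^ ((ch w).card + (Ms w).card + (Mc w).card))) *
    (((2 : ℝ)) ^ (Ms w).card * ((1 : ℝ)) ^ (Mc w).card * ∏ u ∈ ch w, (2 * ((((univ.filter fun z : α → Bool =>
        (¬ (openGraph (labelledOpen ends (fun y => z y && mQ u y))).Reachable c u ∧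
        ¬ (openGraph (labelledOpen ends (fun y => z y && mQ u y))).Reachable c s)).card) : ℕ) : ℝ) + (((univ.filter fun z : α → Bool =>
        (¬ (openGraph (labelledOpen ends (fun y => z y && mQ u y))).Reachable s u ∧
        ¬ (openGraph (labelledOpen ends (fun y => z y && mQ u y))).Reachable s c)).card : ℕ) : ℝ) - (((univ.filter fun z : α → Bool =>
        ((¬ (openGraph (labelledOpen ends (fun y => z y && mQ u y))).Reachable s u ∧
        ¬ (openGraph (labelledOpen ends (fun y => z y && mQ u y))).Reachable s c) ∧
        (¬ (openGraph (labelledOpen ends (fun y => z y && mQ u y))).Reachable c u ∧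
        ¬ (openGraph (labelledOpen ends (fun y => z y && mQ u y))).Reachable c s))).card : ℕ) : ℝ))) := by
  obtain ⟨hws, hwc⟩ := hT w hw
  obtain ⟨hQP, hPT, hP, hQ⟩ := family_hyps (ends := ends) (s := s) (c := c) (T := T) (ch := ch) (mQ := mQ) (Sv := Sv) (e := e) (Ms := Ms) (Mc := Mc) hT hch he hMs hMc hSv1 hSv2 hSv3 hSv4 hSv5 w hw
  have hfam := card_parallel_family_isoC ends s w c
    (fun j => Sum.elim (fun u => fun y => decide (y = e u) || mQ u y) (fun m => fun y => decide (y = m)) j)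
    (fun j => Sum.elim (fun u => Sv u) (fun _ => fun _ => False) j)
    (Ne.symm hwc) hsc
    ((ch w).map ⟨Sum.inl, Sum.inl_injective⟩ ∪ (Ms w ∪ Mc w).map ⟨Sum.inr, Sum.inr_injective⟩) hQP hPT hP hQ
  have hM : ∀ y, decide (∃ j ∈ (ch w).map ⟨Sum.inl, Sum.inl_injective⟩ ∪ (Ms w ∪ Mc w).map ⟨Sum.inr, Sum.inr_injective⟩,
      (fun j => Sum.elim (fun u => fun y => decide (y = e u) || mQ u y) (fun m => fun y => decide (y = m)) j) j y = true) = mQ w y :=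
    fun y => unionMask_eq (T := T) (ch := ch) (mQ := mQ) (e := e) (Ms := Ms) (Mc := Mc) hmQ w hw y
  simp only [hM] at hfam
  have hMM := marks_disjoint (ends := ends) (s := s) (c := c) (T := T) (Ms := Ms) (Mc := Mc) hsc hT hMs hMc w hw
  obtain ⟨hsplit, hcard⟩ := prod_family (ch := ch) (mQ := mQ) (e := e) (Ms := Ms) (Mc := Mc) w (fun mk : α → Bool => (((univ.filter fun z : α → Bool =>
        (¬ (openGraph (labelledOpen ends (fun y => z y && mk y))).Reachable c w ∧
        ¬ (openGraph (labelledOpen ends (fun y => z y && mk y))).Reachable c s)).card : ℕ) : ℝ)) hMM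
  have hfamR := congrArg (fun n : ℕ => (n : ℝ)) hfam
  simp only [Nat.cast_mul, Nat.cast_pow, Nat.cast_prod] at hfamR
  rw [hsplit, hcard] at hfamR
  -- the children: series pieces
  have hser : ∀ u ∈ ch w, ((((univ.filter fun z : α → Bool =>
        (¬ (openGraph (labelledOpen ends (fun y => z y && (decide (y = e u) || mQ u y)))).Reachable c w ∧
        ¬ (openGraph (labelledOpen ends (fun y => z y && (decide (y = e u) || mQ u y)))).Reachable c s)).card) : ℕ) : ℝ) = (2 * ((((univ.filter fun z : α → Bool =>
        (¬ (openGraph (labelledOpen ends (fun y => z y && mQ u y))).Reachable c u ∧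
        ¬ (openGraph (labelledOpen ends (fun y => z y && mQ u y))).Reachable c s)).card) : ℕ) : ℝ) + (((univ.filter fun z : α → Bool =>
        (¬ (openGraph (labelledOpen ends (fun y => z y && mQ u y))).Reachable s u ∧
        ¬ (openGraph (labelledOpen ends (fun y => z y && mQ u y))).Reachable s c)).card : ℕ) : ℝ) - (((univ.filter fun z : α → Bool =>
        ((¬ (openGraph (labelledOpen ends (fun y => z y && mQ u y))).Reachable s u ∧
        ¬ (openGraph (labelledOpen ends (fun y => z y && mQ u y))).Reachable s c) ∧
        (¬ (openGraph (labelledOpen ends (fun y => z y && mQ u y))).Reachable c u ∧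
        ¬ (openGraph (labelledOpen ends (fun y => z y && mQ u y))).Reachable c s))).card : ℕ) : ℝ)) / 2 := by
    intro u hu
    obtain ⟨hua, hQu, heQ⟩ := child_hyps (ends := ends) (s := s) (c := c) (T := T) (ch := ch) (mQ := mQ) (Sv := Sv) (e := e) hT hch he hSv1 hSv2 hSv4 w hw u hu
    have h2 := two_mul_card_series_isoC_mask ends s w c u (e u) (mQ u) (he w hw u hu) hua (Ne.symm hws) (Ne.symm hwc) hQu heQ
    have hf := card_series_nsc_forms (ends := ends) (s := s) (c := c) (Qu := fun y => mQ u y = true)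
    have ha := card_series_nsc_add_S0 (ends := ends) (s := s) (c := c) (u := u) (Qu := fun y => mQ u y = true)
    simp only [Bool.decide_eq_true] at hf ha
    have hfR1 := congrArg (fun n : ℕ => (n : ℝ)) hf.1
    have hfR2 := congrArg (fun n : ℕ => (n : ℝ)) hf.2
    have haR := congrArg (fun n : ℕ => (n : ℝ)) ha
    push_cast at hfR1 hfR2 haR
    have h2R := congrArg (fun n : ℕ => (n : ℝ)) h2
    push_cast at h2R
    linarith
  -- the marks
  have hmS : ∀ m ∈ Ms w, ((((univ.filter fun z : α → Bool =>
        (¬ (openGraph (labelledOpen ends (fun y => z y && decide (y = m)))).Reachable c w ∧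
        ¬ (openGraph (labelledOpen ends (fun y => z y && decide (y = m)))).Reachable c s)).card) : ℕ) : ℝ) = (((univ : Finset (α → Bool)).card : ℝ) / 2) * (2 : ℝ) := by
    intro m hm
    have h2 := two_mul_card_markS_isoC ends s w c m (hMs w hw m hm) (Ne.symm hws) (Ne.symm hwc) hsc
    have h2R := congrArg (fun n : ℕ => (n : ℝ)) h2
    push_cast at h2R
    linarith
  have hmC : ∀ m ∈ Mc w, ((((univ.filter fun z : α → Bool =>
        (¬ (openGraph (labelledOpen ends (fun y => z y && decide (y = m)))).Reachable c w ∧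
        ¬ (openGraph (labelledOpen ends (fun y => z y && decide (y = m)))).Reachable c s)).card) : ℕ) : ℝ) = (((univ : Finset (α → Bool)).card : ℝ) / 2) * (1 : ℝ) := by
    intro m hm
    have h2 := two_mul_card_markC_isoC ends s w c m (hMc w hw m hm) (Ne.symm hws) (Ne.symm hwc) hsc
    have h2R := congrArg (fun n : ℕ => (n : ℝ)) h2
    push_cast at h2R
    linarith
  rw [Finset.prod_congr rfl hser, Finset.prod_congr rfl hmS, Finset.prod_congr rfl hmC, Finset.prod_div_distrib,
    Finset.prod_const, Finset.prod_const, Finset.prod_const] at hfamR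
  have hU : (0 : ℝ) < ((univ : Finset (α → Bool)).card : ℝ) := by exact_mod_cast Finset.card_pos.mpr Finset.univ_nonempty
  exact assemble_eq' _ _ _ _ _ _ _ _ hU hfamR

open Classical in
/-- **Vertex identity, `isoS`**: at a trunk vertex the statistic equals the scaled recursion product over the children. [this work] -/
theorem vertex_isoS
    (hsc : s ≠ c) (hT : ∀ v, T v → v ≠ s ∧ v ≠ c)
    (hch : ∀ v, T v → ∀ u ∈ ch v, T u)
    (he : ∀ v, T v → ∀ u ∈ ch v, ends (e u) = s(v, u))
    (hMs : ∀ v, T v → ∀ m ∈ Ms v, ends m = s(v, s)) (hMc : ∀ v, T v → ∀ m ∈ Mc v, ends m = s(v, c))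
    (hmQ : ∀ v, T v → ∀ l, (mQ v l = true ↔ (∃ u ∈ ch v, l = e u ∨ mQ u l = true) ∨ l ∈ Ms v ∨ l ∈ Mc v))
    (hSv1 : ∀ u, T u → Sv u u)
    (hSv2 : ∀ u, T u → ∀ l, mQ u l = true → (∀ x ∈ ends l, Sv u x ∨ (x = s ∨ x = c)) ∧ (∃ x ∈ ends l, Sv u x))
    (hSv3 : ∀ u, T u → ∀ x, Sv u x → x ≠ s ∧ x ≠ c)
    (hSv4 : ∀ v, T v → ∀ u ∈ ch v, ∀ x, Sv u x → x ≠ v)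
    (hSv5 : ∀ v, T v → ∀ u ∈ ch v, ∀ u' ∈ ch v, u ≠ u' → ∀ x, Sv u x → ¬ Sv u' x)
    (w : V) (hw : T w) :
    ((((univ.filter fun z : α → Bool =>
        (¬ (openGraph (labelledOpen ends (fun y => z y && mQ w y))).Reachable s w ∧
        ¬ (openGraph (labelledOpen ends (fun y => z y && mQ w y))).Reachable s c)).card) : ℕ) : ℝ) =
    (((univ : Finset (α → Bool)).card : ℝ) ^ (1 + (Ms w).card + (Mc w).card) /
      (((univ : Finset (α → Bool)).card : ℝ) ^ ((ch w).card + (Ms w).card + (Mc w).card) * 2 ^ ((ch w).card + (Ms w).card + (Mc w).card))) *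
    (((1 : ℝ)) ^ (Ms w).card * ((2 : ℝ)) ^ (Mc w).card * ∏ u ∈ ch w, (((((univ.filter fun z : α → Bool =>
        (¬ (openGraph (labelledOpen ends (fun y => z y && mQ u y))).Reachable c u ∧
        ¬ (openGraph (labelledOpen ends (fun y => z y && mQ u y))).Reachable c s)).card) : ℕ) : ℝ) + 2 * (((univ.filter fun z : α → Bool =>
        (¬ (openGraph (labelledOpen ends (fun y => z y && mQ u y))).Reachable s u ∧
        ¬ (openGraph (labelledOpen ends (fun y => z y && mQ u y))).Reachable s c)).card : ℕ) : ℝ) - (((univ.filter fun z : α → Bool =>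
        ((¬ (openGraph (labelledOpen ends (fun y => z y && mQ u y))).Reachable s u ∧
        ¬ (openGraph (labelledOpen ends (fun y => z y && mQ u y))).Reachable s c) ∧
        (¬ (openGraph (labelledOpen ends (fun y => z y && mQ u y))).Reachable c u ∧
        ¬ (openGraph (labelledOpen ends (fun y => z y && mQ u y))).Reachable c s))).card : ℕ) : ℝ))) := by
  obtain ⟨hws, hwc⟩ := hT w hw
  obtain ⟨hQP, hPT, hP, hQ⟩ := family_hyps (ends := ends) (s := s) (c := c) (T := T) (ch := ch) (mQ := mQ) (Sv := Sv) (e := e) (Ms := Ms) (Mc := Mc) hT hch he hMs hMc hSv1 hSv2 hSv3 hSv4 hSv5 w hw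
  have hfam := card_parallel_family_isoS ends s w c
    (fun j => Sum.elim (fun u => fun y => decide (y = e u) || mQ u y) (fun m => fun y => decide (y = m)) j)
    (fun j => Sum.elim (fun u => Sv u) (fun _ => fun _ => False) j)
    (Ne.symm hws) hsc
    ((ch w).map ⟨Sum.inl, Sum.inl_injective⟩ ∪ (Ms w ∪ Mc w).map ⟨Sum.inr, Sum.inr_injective⟩) hQP hPT hP hQ
  have hM : ∀ y, decide (∃ j ∈ (ch w).map ⟨Sum.inl, Sum.inl_injective⟩ ∪ (Ms w ∪ Mc w).map ⟨Sum.inr, Sum.inr_injective⟩,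
      (fun j => Sum.elim (fun u => fun y => decide (y = e u) || mQ u y) (fun m => fun y => decide (y = m)) j) j y = true) = mQ w y :=
    fun y => unionMask_eq (T := T) (ch := ch) (mQ := mQ) (e := e) (Ms := Ms) (Mc := Mc) hmQ w hw y
  simp only [hM] at hfam
  have hMM := marks_disjoint (ends := ends) (s := s) (c := c) (T := T) (Ms := Ms) (Mc := Mc) hsc hT hMs hMc w hw
  obtain ⟨hsplit, hcard⟩ := prod_family (ch := ch) (mQ := mQ) (e := e) (Ms := Ms) (Mc := Mc) w (fun mk : α → Bool => (((univ.filter fun z : α → Bool =>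
        (¬ (openGraph (labelledOpen ends (fun y => z y && mk y))).Reachable s w ∧
        ¬ (openGraph (labelledOpen ends (fun y => z y && mk y))).Reachable s c)).card : ℕ) : ℝ)) hMM
  have hfamR := congrArg (fun n : ℕ => (n : ℝ)) hfam
  simp only [Nat.cast_mul, Nat.cast_pow, Nat.cast_prod] at hfamR
  rw [hsplit, hcard] at hfamR
  -- the children: series pieces
  have hser : ∀ u ∈ ch w, ((((univ.filter fun z : α → Bool =>
        (¬ (openGraph (labelledOpen ends (fun y => z y && (decide (y = e u) || mQ u y)))).Reachable s w ∧
        ¬ (openGraph (labelledOpen ends (fun y => z y && (decide (y = e u) || mQ u y)))).Reachable s c)).card) : ℕ) : ℝ) = (((((univ.filter fun z : α → Bool =>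
        (¬ (openGraph (labelledOpen ends (fun y => z y && mQ u y))).Reachable c u ∧
        ¬ (openGraph (labelledOpen ends (fun y => z y && mQ u y))).Reachable c s)).card) : ℕ) : ℝ) + 2 * (((univ.filter fun z : α → Bool =>
        (¬ (openGraph (labelledOpen ends (fun y => z y && mQ u y))).Reachable s u ∧
        ¬ (openGraph (labelledOpen ends (fun y => z y && mQ u y))).Reachable s c)).card : ℕ) : ℝ) - (((univ.filter fun z : α → Bool =>
        ((¬ (openGraph (labelledOpen ends (fun y => z y && mQ u y))).Reachable s u ∧
        ¬ (openGraph (labelledOpen ends (fun y => z y && mQ u y))).Reachable s c) ∧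
        (¬ (openGraph (labelledOpen ends (fun y => z y && mQ u y))).Reachable c u ∧
        ¬ (openGraph (labelledOpen ends (fun y => z y && mQ u y))).Reachable c s))).card : ℕ) : ℝ)) / 2 := by
    intro u hu
    obtain ⟨hua, hQu, heQ⟩ := child_hyps (ends := ends) (s := s) (c := c) (T := T) (ch := ch) (mQ := mQ) (Sv := Sv) (e := e) hT hch he hSv1 hSv2 hSv4 w hw u hu
    have h2 := two_mul_card_series_isoS_mask ends s w c u (e u) (mQ u) (he w hw u hu) hua (Ne.symm hws) (Ne.symm hwc) hQu heQ
    have hf := card_series_nsc_forms (ends := ends) (s := s) (c := c) (Qu := fun y => mQ u y = true)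
    have ha := card_series_nsc_add_S0 (ends := ends) (s := s) (c := c) (u := u) (Qu := fun y => mQ u y = true)
    simp only [Bool.decide_eq_true] at hf ha
    have hfR1 := congrArg (fun n : ℕ => (n : ℝ)) hf.1
    have hfR2 := congrArg (fun n : ℕ => (n : ℝ)) hf.2
    have haR := congrArg (fun n : ℕ => (n : ℝ)) ha
    push_cast at hfR1 hfR2 haR
    have h2R := congrArg (fun n : ℕ => (n : ℝ)) h2
    push_cast at h2R
    linarith
  -- the marks
  have hmS : ∀ m ∈ Ms w, ((((univ.filter fun z : α → Bool =>
        (¬ (openGraph (labelledOpen ends (fun y => z y && decide (y = m)))).Reachable s w ∧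
        ¬ (openGraph (labelledOpen ends (fun y => z y && decide (y = m)))).Reachable s c)).card) : ℕ) : ℝ) = (((univ : Finset (α → Bool)).card : ℝ) / 2) * (1 : ℝ) := by
    intro m hm
    have h2 := two_mul_card_markS_isoS ends s w c m (hMs w hw m hm) (Ne.symm hws) (Ne.symm hwc) hsc
    have h2R := congrArg (fun n : ℕ => (n : ℝ)) h2
    push_cast at h2R
    linarith
  have hmC : ∀ m ∈ Mc w, ((((univ.filter fun z : α → Bool =>
        (¬ (openGraph (labelledOpen ends (fun y => z y && decide (y = m)))).Reachable s w ∧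
        ¬ (openGraph (labelledOpen ends (fun y => z y && decide (y = m)))).Reachable s c)).card) : ℕ) : ℝ) = (((univ : Finset (α → Bool)).card : ℝ) / 2) * (2 : ℝ) := by
    intro m hm
    have h2 := two_mul_card_markC_isoS ends s w c m (hMc w hw m hm) (Ne.symm hws) (Ne.symm hwc) hsc
    have h2R := congrArg (fun n : ℕ => (n : ℝ)) h2
    push_cast at h2R
    linarith
  rw [Finset.prod_congr rfl hser, Finset.prod_congr rfl hmS, Finset.prod_congr rfl hmC, Finset.prod_div_distrib,
    Finset.prod_const, Finset.prod_const, Finset.prod_const] at hfamR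
  have hU : (0 : ℝ) < ((univ : Finset (α → Bool)).card : ℝ) := by exact_mod_cast Finset.card_pos.mpr Finset.univ_nonempty
  exact assemble_eq' _ _ _ _ _ _ _ _ hU hfamR

end Vertex

end Summit.CriticalPhenomena.PercolationContinuityZ3.Theorems.ProductFormFibre
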